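import Literature.AlgebraicTopology.KTheory.WedgeCollapse
import HarnessLib

/-!
# The triple smash product and associativity of `X ∧ Y`

For compact Hausdorff pointed spaces the iterated smash products `(X ∧ Y) ∧ Z` and
`X ∧ (Y ∧ Z)` (with `X ∧ Y = (X × Y)/(X ∨ Y)` modelled by `Collapse`) are both canonically
homeomorphic to the **triple smash** `X ∧ Y ∧ Z = (X × Y × Z)/W₃`, `W₃` the fat wedge
`{x = x₀} ∪ {y = y₀} ∪ {z = z₀}` (Hatcher, *Algebraic Topology*, §4.F / p. 10: the smash product of
compact Hausdorff — indeed CW — pointed spaces is associative). Everything is proved: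

* §1 the fat wedge `fatWedge x₀ y₀ z₀` and **extension of invertible matrices of functions
  from `W₃` to `X × Y × Z`** (`exists_extend_fatWedge`:
  `G = G₁ · G₁(x₀,·,·)⁻¹ · g(x₀,·,·)` with `G₁(x,y,z) = g(x,y,z₀) g(x,y₀,z₀)⁻¹ g(x,y₀,z)`), hence
  **injectivity of `q^* : K̃(X ∧ Y ∧ Z) → K⁰(X × Y × Z)`** (`eq_zero_of_quotK_fatWedge_eq_zero`),
  by the criterion of `WedgeCollapse.lean`;
* §2 `Smash3 x₀ y₀ z₀`, the continuous bijections `smash3ToLeft : X ∧ Y ∧ Z → (X ∧ Y) ∧ Z`,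
  `smash3ToRight : X ∧ Y ∧ Z → X ∧ (Y ∧ Z)` and the homeomorphisms `smash3HomeoLeft/Right`
  (compact to Hausdorff), the **associator** `smashAssoc : (X ∧ Y) ∧ Z ≃ₜ X ∧ (Y ∧ Z)` and the
  commutation of all these with the quotient maps and base points.

The compatibility of the `K̃`-cup products with the associator is in `SphereProducts.lean`.

## References

* A. Hatcher, *Algebraic Topology*, CUP (2002), Ch. 0 p. 10 (smash product; associativity for
  CW complexes) and §4.F. [HatcherAT2002]
* A. Hatcher, *Vector Bundles and K-Theory* (v2.2, 2017), §2.1 p. 55 (the splitting behind the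
  injectivity of `K̃(X ∧ Y) → K⁰(X × Y)`). [HatcherVBKT2017]

## Design notes

* No quotient-of-a-product topology is needed: the maps go *out of* the triple smash (a plain
  `Collapse.lift`) and are continuous bijections from a compact space to a Hausdorff space.
-/

noncomputable section

namespace Literature.AlgebraicTopology.KTheory

open Literature.RingTheory.KTheory Matrix Set TopologicalSpace

universe u v w

variable {X : Type u} [TopologicalSpace X] {Y : Type v} [TopologicalSpace Y] {Z : Type w} [TopologicalSpace Z]

/-! ### 1. The fat wedge and extension of invertible matrices -/

section FatWedge

/-- The **fat wedge** `W₃ = {x = x₀} ∪ {y = y₀} ∪ {z = z₀} ⊆ X × Y × Z`. [cite: HatcherAT2002, Ch. 0 p. 10] -/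
def fatWedge (x₀ : X) (y₀ : Y) (z₀ : Z) : Set (X × Y × Z) := {p | p.1 = x₀ ∨ p.2.1 = y₀ ∨ p.2.2 = z₀}

omit [TopologicalSpace X] [TopologicalSpace Y] [TopologicalSpace Z] in
/-- Smash products (Hatcher AT Ch. 0). [folklore] -/
theorem mem_fatWedge {x₀ : X} {y₀ : Y} {z₀ : Z} {p : X × Y × Z} : p ∈ fatWedge x₀ y₀ z₀ ↔ p.1 = x₀ ∨ p.2.1 = y₀ ∨ p.2.2 = z₀ :=
  Iff.rfl

/-- Smash products (Hatcher AT Ch. 0). [folklore] -/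
theorem isClosed_fatWedge [T1Space X] [T1Space Y] [T1Space Z] (x₀ : X) (y₀ : Y) (z₀ : Z) : IsClosed (fatWedge x₀ y₀ z₀) :=
  ((isClosed_singleton.preimage continuous_fst).union
    ((isClosed_singleton.preimage (continuous_fst.comp continuous_snd)).union
      (isClosed_singleton.preimage (continuous_snd.comp continuous_snd))))

/-- The fat wedge as a closed set. [cite: HatcherAT2002, Ch. 0 p. 10] -/
def fatWedgeC [T1Space X] [T1Space Y] [T1Space Z] (x₀ : X) (y₀ : Y) (z₀ : Z) : Closeds (X × Y × Z) :=
  ⟨fatWedge x₀ y₀ z₀, isClosed_fatWedge x₀ y₀ z₀⟩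

/-- Smash products (Hatcher AT Ch. 0). [folklore] -/
@[simp] theorem coe_fatWedgeC [T1Space X] [T1Space Y] [T1Space Z] (x₀ : X) (y₀ : Y) (z₀ : Z) :
    ((fatWedgeC x₀ y₀ z₀ : Closeds (X × Y × Z)) : Set (X × Y × Z)) = fatWedge x₀ y₀ z₀ := rfl

variable (x₀ : X) (y₀ : Y) (z₀ : Z)

/-- `(x, y, z) ↦ (x, y, z₀) ∈ W₃`. [folklore] -/
def toFW12 : C(X × Y × Z, ↥(fatWedge x₀ y₀ z₀)) :=
  ⟨fun p ↦ ⟨(p.1, p.2.1, z₀), Or.inr (Or.inr rfl)⟩,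
    (continuous_fst.prodMk ((continuous_fst.comp continuous_snd).prodMk continuous_const)).subtype_mk _⟩

/-- `(x, y, z) ↦ (x, y₀, z) ∈ W₃`. [folklore] -/
def toFW13 : C(X × Y × Z, ↥(fatWedge x₀ y₀ z₀)) :=
  ⟨fun p ↦ ⟨(p.1, y₀, p.2.2), Or.inr (Or.inl rfl)⟩,
    (continuous_fst.prodMk (continuous_const.prodMk (continuous_snd.comp continuous_snd))).subtype_mk _⟩

/-- `(x, y, z) ↦ (x, y₀, z₀) ∈ W₃`. [folklore] -/
def toFW1 : C(X × Y × Z, ↥(fatWedge x₀ y₀ z₀)) :=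
  ⟨fun p ↦ ⟨(p.1, y₀, z₀), Or.inr (Or.inl rfl)⟩, (continuous_fst.prodMk continuous_const).subtype_mk _⟩

/-- `(x, y, z) ↦ (x₀, y, z) ∈ W₃`. [folklore] -/
def toFW23 : C(X × Y × Z, ↥(fatWedge x₀ y₀ z₀)) :=
  ⟨fun p ↦ ⟨(x₀, p.2), Or.inl rfl⟩, (continuous_const.prodMk continuous_snd).subtype_mk _⟩

/-- `(x, y, z) ↦ (x₀, y, z)`. [folklore] -/
def rho23 : C(X × Y × Z, X × Y × Z) := ⟨fun p ↦ (x₀, p.2), continuous_const.prodMk continuous_snd⟩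

/-- **Invertible matrices of functions on the fat wedge extend to the triple product**: with
`G₁(x,y,z) = g(x,y,z₀) g(x,y₀,z₀)⁻¹ g(x,y₀,z)` (the two-factor extension of `WedgeCollapse`
applied fibrewise) put `G(x,y,z) = G₁(x,y,z) G₁(x₀,y,z)⁻¹ g(x₀,y,z)`; on `z = z₀` and on `y = y₀`
one has `G₁ = g` there, and on `x = x₀` the first two factors cancel. [cite: HatcherVBKT2017, §2.1 p. 55] -/
theorem exists_extend_fatWedge {r : Type*} [Fintype r] [DecidableEq r]
    (g g' : Matrix r r C(↥(fatWedge x₀ y₀ z₀), ℂ)) (hgg' : g * g' = 1) (hg'g : g' * g = 1) :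
    ∃ G G' : Matrix r r C(X × Y × Z, ℂ), G * G' = 1 ∧ G' * G = 1 ∧ G.map (resHom (fatWedge x₀ y₀ z₀)) = g := by
  set c12 : C(↥(fatWedge x₀ y₀ z₀), ℂ) →+* C(X × Y × Z, ℂ) := comapRingHom (toFW12 x₀ y₀ z₀)
  set c13 : C(↥(fatWedge x₀ y₀ z₀), ℂ) →+* C(X × Y × Z, ℂ) := comapRingHom (toFW13 x₀ y₀ z₀)
  set c1 : C(↥(fatWedge x₀ y₀ z₀), ℂ) →+* C(X × Y × Z, ℂ) := comapRingHom (toFW1 x₀ y₀ z₀)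
  set c23 : C(↥(fatWedge x₀ y₀ z₀), ℂ) →+* C(X × Y × Z, ℂ) := comapRingHom (toFW23 x₀ y₀ z₀)
  set ρ : C(X × Y × Z, ℂ) →+* C(X × Y × Z, ℂ) := comapRingHom (rho23 (Y := Y) (Z := Z) x₀)
  have h1 : ∀ (f : C(↥(fatWedge x₀ y₀ z₀), ℂ) →+* C(X × Y × Z, ℂ)), g.map f * g'.map f = 1 := fun f ↦ by
    rw [← Matrix.map_mul, hgg', Matrix.map_one _ (map_zero f) (map_one f)]
  have h2 : ∀ (f : C(↥(fatWedge x₀ y₀ z₀), ℂ) →+* C(X × Y × Z, ℂ)), g'.map f * g.map f = 1 := fun f ↦ by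
    rw [← Matrix.map_mul, hg'g, Matrix.map_one _ (map_zero f) (map_one f)]
  set G₁ := g.map c12 * g'.map c1 * g.map c13 with hG₁
  set G₁' := g'.map c13 * g.map c1 * g'.map c12 with hG₁'
  have hG₁G₁' : G₁ * G₁' = 1 := by
    calc G₁ * G₁' = g.map c12 * (g'.map c1 * ((g.map c13 * g'.map c13) * g.map c1)) * g'.map c12 := by
          simp only [hG₁, hG₁', Matrix.mul_assoc]
      _ = 1 := by rw [h1, Matrix.one_mul, h2, Matrix.mul_one, h1]
  have hG₁'G₁ : G₁' * G₁ = 1 := by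
    calc G₁' * G₁ = g'.map c13 * (g.map c1 * ((g'.map c12 * g.map c12) * g'.map c1)) * g.map c13 := by
          simp only [hG₁, hG₁', Matrix.mul_assoc]
      _ = 1 := by rw [h2, Matrix.one_mul, h1, Matrix.mul_one, h2]
  refine ⟨G₁ * G₁'.map ρ * g.map c23, g'.map c23 * G₁.map ρ * G₁', ?_, ?_, ?_⟩
  · calc G₁ * G₁'.map ρ * g.map c23 * (g'.map c23 * G₁.map ρ * G₁')
          = G₁ * (G₁'.map ρ * ((g.map c23 * g'.map c23) * G₁.map ρ)) * G₁' := by simp only [Matrix.mul_assoc]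
      _ = 1 := by rw [h1, Matrix.one_mul, ← Matrix.map_mul, hG₁'G₁, Matrix.map_one _ (map_zero ρ) (map_one ρ), Matrix.mul_one, hG₁G₁']
  · calc g'.map c23 * G₁.map ρ * G₁' * (G₁ * G₁'.map ρ * g.map c23)
          = g'.map c23 * (G₁.map ρ * ((G₁' * G₁) * G₁'.map ρ)) * g.map c23 := by simp only [Matrix.mul_assoc]
      _ = 1 := by rw [hG₁'G₁, Matrix.one_mul, ← Matrix.map_mul, hG₁G₁', Matrix.map_one _ (map_zero ρ) (map_one ρ), Matrix.mul_one, h2]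
  · refine matrix_eq_of_forall_map_evalRingHom fun w ↦ ?_
    obtain ⟨⟨x, y, z⟩, hw⟩ := w
    have hmul : ∀ (q : ↥(fatWedge x₀ y₀ z₀)), g.map (evalRingHom q) * g'.map (evalRingHom q) = 1 := fun q ↦ by
      rw [← Matrix.map_mul, hgg', Matrix.map_one _ (map_zero _) (map_one _)]
    have hmul' : ∀ (q : ↥(fatWedge x₀ y₀ z₀)), g'.map (evalRingHom q) * g.map (evalRingHom q) = 1 := fun q ↦ by
      rw [← Matrix.map_mul, hg'g, Matrix.map_one _ (map_zero _) (map_one _)]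
    -- evaluation of the pulled-back factors at the point `(x, y, z)` of the fat wedge
    have hev12 : ∀ M : Matrix r r C(↥(fatWedge x₀ y₀ z₀), ℂ), ((M.map c12).map (resHom (fatWedge x₀ y₀ z₀))).map (evalRingHom ⟨(x, y, z), hw⟩) =
        M.map (evalRingHom ⟨(x, y, z₀), Or.inr (Or.inr rfl)⟩) := fun M ↦ by
      rw [Matrix.map_map, Matrix.map_map, ← RingHom.coe_comp, ← RingHom.coe_comp]; rfl
    have hev13 : ∀ M : Matrix r r C(↥(fatWedge x₀ y₀ z₀), ℂ), ((M.map c13).map (resHom (fatWedge x₀ y₀ z₀))).map (evalRingHom ⟨(x, y, z), hw⟩) =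
        M.map (evalRingHom ⟨(x, y₀, z), Or.inr (Or.inl rfl)⟩) := fun M ↦ by
      rw [Matrix.map_map, Matrix.map_map, ← RingHom.coe_comp, ← RingHom.coe_comp]; rfl
    have hev1 : ∀ M : Matrix r r C(↥(fatWedge x₀ y₀ z₀), ℂ), ((M.map c1).map (resHom (fatWedge x₀ y₀ z₀))).map (evalRingHom ⟨(x, y, z), hw⟩) =
        M.map (evalRingHom ⟨(x, y₀, z₀), Or.inr (Or.inl rfl)⟩) := fun M ↦ by
      rw [Matrix.map_map, Matrix.map_map, ← RingHom.coe_comp, ← RingHom.coe_comp]; rfl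
    have hev23 : ∀ M : Matrix r r C(↥(fatWedge x₀ y₀ z₀), ℂ), ((M.map c23).map (resHom (fatWedge x₀ y₀ z₀))).map (evalRingHom ⟨(x, y, z), hw⟩) =
        M.map (evalRingHom ⟨(x₀, y, z), Or.inl rfl⟩) := fun M ↦ by
      rw [Matrix.map_map, Matrix.map_map, ← RingHom.coe_comp, ← RingHom.coe_comp]; rfl
    have hρ12 : ∀ M : Matrix r r C(↥(fatWedge x₀ y₀ z₀), ℂ), (((M.map c12).map ρ).map (resHom (fatWedge x₀ y₀ z₀))).map (evalRingHom ⟨(x, y, z), hw⟩) =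
        M.map (evalRingHom ⟨(x₀, y, z₀), Or.inr (Or.inr rfl)⟩) := fun M ↦ by
      rw [Matrix.map_map, Matrix.map_map, Matrix.map_map, ← RingHom.coe_comp, ← RingHom.coe_comp, ← RingHom.coe_comp]; rfl
    have hρ13 : ∀ M : Matrix r r C(↥(fatWedge x₀ y₀ z₀), ℂ), (((M.map c13).map ρ).map (resHom (fatWedge x₀ y₀ z₀))).map (evalRingHom ⟨(x, y, z), hw⟩) =
        M.map (evalRingHom ⟨(x₀, y₀, z), Or.inr (Or.inl rfl)⟩) := fun M ↦ by
      rw [Matrix.map_map, Matrix.map_map, Matrix.map_map, ← RingHom.coe_comp, ← RingHom.coe_comp, ← RingHom.coe_comp]; rfl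
    have hρ1 : ∀ M : Matrix r r C(↥(fatWedge x₀ y₀ z₀), ℂ), (((M.map c1).map ρ).map (resHom (fatWedge x₀ y₀ z₀))).map (evalRingHom ⟨(x, y, z), hw⟩) =
        M.map (evalRingHom ⟨(x₀, y₀, z₀), Or.inr (Or.inl rfl)⟩) := fun M ↦ by
      rw [Matrix.map_map, Matrix.map_map, Matrix.map_map, ← RingHom.coe_comp, ← RingHom.coe_comp, ← RingHom.coe_comp]; rfl
    simp only [hG₁, hG₁', Matrix.map_mul, hev12, hev13, hev1, hev23, hρ12, hρ13, hρ1]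
    rcases hw with hx | hy | hz
    · -- `x = x₀`: the first six factors cancel
      change x = x₀ at hx
      subst hx
      calc g.map (evalRingHom ⟨(x, y, z₀), _⟩) * g'.map (evalRingHom ⟨(x, y₀, z₀), _⟩) * g.map (evalRingHom ⟨(x, y₀, z), _⟩) *
            (g'.map (evalRingHom ⟨(x, y₀, z), _⟩) * g.map (evalRingHom ⟨(x, y₀, z₀), _⟩) * g'.map (evalRingHom ⟨(x, y, z₀), _⟩)) *
            g.map (evalRingHom ⟨(x, y, z), _⟩)
            = g.map (evalRingHom ⟨(x, y, z₀), Or.inr (Or.inr rfl)⟩) *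
                (g'.map (evalRingHom ⟨(x, y₀, z₀), Or.inr (Or.inl rfl)⟩) *
                  ((g.map (evalRingHom ⟨(x, y₀, z), Or.inr (Or.inl rfl)⟩) * g'.map (evalRingHom ⟨(x, y₀, z), Or.inr (Or.inl rfl)⟩)) *
                    g.map (evalRingHom ⟨(x, y₀, z₀), Or.inr (Or.inl rfl)⟩)) *
                  g'.map (evalRingHom ⟨(x, y, z₀), Or.inr (Or.inr rfl)⟩)) *
              g.map (evalRingHom ⟨(x, y, z), Or.inl rfl⟩) := by simp only [Matrix.mul_assoc]
        _ = g.map (evalRingHom ⟨(x, y, z), Or.inl rfl⟩) := by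
            rw [hmul, Matrix.one_mul, hmul', Matrix.one_mul, hmul, Matrix.one_mul]
    · -- `y = y₀`
      change y = y₀ at hy
      subst hy
      rw [hmul, Matrix.one_mul, Matrix.mul_assoc (g'.map _), hmul, Matrix.mul_one, Matrix.mul_assoc, hmul', Matrix.mul_one]
    · -- `z = z₀`
      change z = z₀ at hz
      subst hz
      rw [Matrix.mul_assoc (g.map _), hmul', Matrix.mul_one, hmul', Matrix.one_mul, Matrix.mul_assoc, hmul', Matrix.mul_one]

variable [T1Space X] [T1Space Y] [T1Space Z]

/-- **`q^* : K̃(X ∧ Y ∧ Z) → K⁰(X × Y × Z)` is injective.** [cite: HatcherVBKT2017, §2.1 p. 55] -/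
theorem eq_zero_of_quotK_fatWedge_eq_zero {b : K0 (Collapse (X × Y × Z) (fatWedgeC x₀ y₀ z₀))}
    (hb : b ∈ Reduced (Collapse (X × Y × Z) (fatWedgeC x₀ y₀ z₀)) (Collapse.pt (fatWedgeC x₀ y₀ z₀)))
    (h0 : quotK (fatWedgeC x₀ y₀ z₀) b = 0) : b = 0 :=
  eq_zero_of_quotK_eq_zero (fun _ g g' hgg' hg'g ↦ exists_extend_fatWedge x₀ y₀ z₀ g g' hgg' hg'g) hb h0

/-- Uniqueness of reduced lifts to the triple smash. [cite: HatcherVBKT2017, §2.1 p. 55] -/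
theorem reduced_smash3_ext {c c' : K0 (Collapse (X × Y × Z) (fatWedgeC x₀ y₀ z₀))}
    (hc : c ∈ Reduced (Collapse (X × Y × Z) (fatWedgeC x₀ y₀ z₀)) (Collapse.pt (fatWedgeC x₀ y₀ z₀)))
    (hc' : c' ∈ Reduced (Collapse (X × Y × Z) (fatWedgeC x₀ y₀ z₀)) (Collapse.pt (fatWedgeC x₀ y₀ z₀)))
    (h : quotK (fatWedgeC x₀ y₀ z₀) c = quotK (fatWedgeC x₀ y₀ z₀) c') : c = c' := by
  rw [← sub_eq_zero]
  exact eq_zero_of_quotK_fatWedge_eq_zero x₀ y₀ z₀ (sub_mem hc hc') (by rw [map_sub, h, sub_self])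

end FatWedge

/-! ### 2. The triple smash and the two iterated smashes -/

section Smash3

variable [CompactSpace X] [T2Space X] [CompactSpace Y] [T2Space Y] [CompactSpace Z] [T2Space Z]

/-- The **triple smash product** `X ∧ Y ∧ Z = (X × Y × Z)/W₃`. [cite: HatcherAT2002, Ch. 0 p. 10] -/
abbrev Smash3 (x₀ : X) (y₀ : Y) (z₀ : Z) : Type (max u v w) := Collapse (X × Y × Z) (fatWedgeC x₀ y₀ z₀)

/-- `(X ∧ Y) ∧ Z` in the `Collapse` model. [cite: HatcherAT2002, Ch. 0 p. 10] -/
abbrev SmashL (x₀ : X) (y₀ : Y) (z₀ : Z) : Type (max u v w) :=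
  Collapse (Collapse (X × Y) (prodWedgeC x₀ y₀) × Z) (prodWedgeC (Collapse.pt (prodWedgeC x₀ y₀)) z₀)

/-- `X ∧ (Y ∧ Z)` in the `Collapse` model. [cite: HatcherAT2002, Ch. 0 p. 10] -/
abbrev SmashR (x₀ : X) (y₀ : Y) (z₀ : Z) : Type (max u v w) :=
  Collapse (X × Collapse (Y × Z) (prodWedgeC y₀ z₀)) (prodWedgeC x₀ (Collapse.pt (prodWedgeC y₀ z₀)))

/-- `X × Y × Z → (X ∧ Y) × Z`. [folklore] -/
def prodToL (x₀ : X) (y₀ : Y) : C(X × Y × Z, Collapse (X × Y) (prodWedgeC x₀ y₀) × Z) :=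
  ((Collapse.mk (prodWedgeC x₀ y₀)).comp ⟨fun p ↦ (p.1, p.2.1), continuous_fst.prodMk (continuous_fst.comp continuous_snd)⟩).prodMk
    ⟨fun p ↦ p.2.2, continuous_snd.comp continuous_snd⟩

/-- `X × Y × Z → X × (Y ∧ Z)`. [folklore] -/
def prodToR (y₀ : Y) (z₀ : Z) : C(X × Y × Z, X × Collapse (Y × Z) (prodWedgeC y₀ z₀)) :=
  (⟨fun p ↦ p.1, continuous_fst⟩ : C(X × Y × Z, X)).prodMk ((Collapse.mk (prodWedgeC y₀ z₀)).comp ⟨fun p ↦ p.2, continuous_snd⟩)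

omit [CompactSpace X] [CompactSpace Y] [CompactSpace Z] [T2Space Z] in
/-- Smash products (Hatcher AT Ch. 0). [folklore] -/
@[simp] theorem prodToL_apply (x₀ : X) (y₀ : Y) (p : X × Y × Z) : prodToL (Z := Z) x₀ y₀ p = (Collapse.mk (prodWedgeC x₀ y₀) (p.1, p.2.1), p.2.2) := rfl

omit [CompactSpace X] [T2Space X] [CompactSpace Y] [CompactSpace Z] in
/-- Smash products (Hatcher AT Ch. 0). [folklore] -/
@[simp] theorem prodToR_apply (y₀ : Y) (z₀ : Z) (p : X × Y × Z) : prodToR (X := X) y₀ z₀ p = (p.1, Collapse.mk (prodWedgeC y₀ z₀) p.2) := rfl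

variable (x₀ : X) (y₀ : Y) (z₀ : Z)

/-- **`X ∧ Y ∧ Z → (X ∧ Y) ∧ Z`**. [cite: HatcherAT2002, Ch. 0 p. 10] -/
def smash3ToLeft : C(Smash3 x₀ y₀ z₀, SmashL x₀ y₀ z₀) :=
  Collapse.lift ((Collapse.mk (prodWedgeC (Collapse.pt (prodWedgeC x₀ y₀)) z₀)).comp (prodToL (Z := Z) x₀ y₀)) (Collapse.pt _)
    (by
      rintro ⟨x, y, z⟩ (hx | hy | hz)
      · exact Collapse.mk_eq_pt (Or.inl (Collapse.mk_eq_pt (Or.inl hx)))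
      · exact Collapse.mk_eq_pt (Or.inl (Collapse.mk_eq_pt (Or.inr hy)))
      · exact Collapse.mk_eq_pt (Or.inr hz))

/-- **`X ∧ Y ∧ Z → X ∧ (Y ∧ Z)`**. [cite: HatcherAT2002, Ch. 0 p. 10] -/
def smash3ToRight : C(Smash3 x₀ y₀ z₀, SmashR x₀ y₀ z₀) :=
  Collapse.lift ((Collapse.mk (prodWedgeC x₀ (Collapse.pt (prodWedgeC y₀ z₀)))).comp (prodToR (X := X) y₀ z₀)) (Collapse.pt _)
    (by
      rintro ⟨x, y, z⟩ (hx | hy | hz)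
      · exact Collapse.mk_eq_pt (Or.inl hx)
      · exact Collapse.mk_eq_pt (Or.inr (Collapse.mk_eq_pt (Or.inl hy)))
      · exact Collapse.mk_eq_pt (Or.inr (Collapse.mk_eq_pt (Or.inr hz))))

omit [CompactSpace Z] in
/-- Smash products (Hatcher AT Ch. 0). [folklore] -/
theorem smash3ToLeft_comp_mk :
    (smash3ToLeft x₀ y₀ z₀).comp (Collapse.mk (fatWedgeC x₀ y₀ z₀)) =
      (Collapse.mk (prodWedgeC (Collapse.pt (prodWedgeC x₀ y₀)) z₀)).comp (prodToL (Z := Z) x₀ y₀) := rfl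

omit [CompactSpace X] in
/-- Smash products (Hatcher AT Ch. 0). [folklore] -/
theorem smash3ToRight_comp_mk :
    (smash3ToRight x₀ y₀ z₀).comp (Collapse.mk (fatWedgeC x₀ y₀ z₀)) =
      (Collapse.mk (prodWedgeC x₀ (Collapse.pt (prodWedgeC y₀ z₀)))).comp (prodToR (X := X) y₀ z₀) := rfl

omit [CompactSpace Z] in
/-- Smash products (Hatcher AT Ch. 0). [folklore] -/
@[simp] theorem smash3ToLeft_mk (p : X × Y × Z) :
    smash3ToLeft x₀ y₀ z₀ (Collapse.mk (fatWedgeC x₀ y₀ z₀) p) =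
      Collapse.mk (prodWedgeC (Collapse.pt (prodWedgeC x₀ y₀)) z₀) (Collapse.mk (prodWedgeC x₀ y₀) (p.1, p.2.1), p.2.2) := rfl

omit [CompactSpace X] in
/-- Smash products (Hatcher AT Ch. 0). [folklore] -/
@[simp] theorem smash3ToRight_mk (p : X × Y × Z) :
    smash3ToRight x₀ y₀ z₀ (Collapse.mk (fatWedgeC x₀ y₀ z₀) p) =
      Collapse.mk (prodWedgeC x₀ (Collapse.pt (prodWedgeC y₀ z₀))) (p.1, Collapse.mk (prodWedgeC y₀ z₀) p.2) := rfl

omit [CompactSpace Z] in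
/-- Smash products (Hatcher AT Ch. 0). [folklore] -/
@[simp] theorem smash3ToLeft_pt : smash3ToLeft x₀ y₀ z₀ (Collapse.pt _) = Collapse.pt _ := rfl

omit [CompactSpace X] in
/-- Smash products (Hatcher AT Ch. 0). [folklore] -/
@[simp] theorem smash3ToRight_pt : smash3ToRight x₀ y₀ z₀ (Collapse.pt _) = Collapse.pt _ := rfl

omit [CompactSpace Z] in
/-- `smash3ToLeft` is a bijection. [cite: HatcherAT2002, Ch. 0 p. 10] -/
theorem smash3ToLeft_bijective : Function.Bijective (smash3ToLeft x₀ y₀ z₀) := by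
  constructor
  · intro a b h
    rcases Collapse.eq_pt_or_eq_mk a with rfl | ⟨p, hp, rfl⟩ <;> rcases Collapse.eq_pt_or_eq_mk b with rfl | ⟨q, hq, rfl⟩
    · rfl
    · exfalso
      rw [smash3ToLeft_pt, smash3ToLeft_mk, eq_comm, Collapse.mk_eq_pt_iff] at h
      rcases h with h | h
      · change Collapse.mk (prodWedgeC x₀ y₀) (q.1, q.2.1) = Collapse.pt _ at h
        rw [Collapse.mk_eq_pt_iff] at h
        rcases h with h | h
        · exact hq (Or.inl h)
        · exact hq (Or.inr (Or.inl h))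
      · exact hq (Or.inr (Or.inr h))
    · exfalso
      rw [smash3ToLeft_pt, smash3ToLeft_mk, Collapse.mk_eq_pt_iff] at h
      rcases h with h | h
      · change Collapse.mk (prodWedgeC x₀ y₀) (p.1, p.2.1) = Collapse.pt _ at h
        rw [Collapse.mk_eq_pt_iff] at h
        rcases h with h | h
        · exact hp (Or.inl h)
        · exact hp (Or.inr (Or.inl h))
      · exact hp (Or.inr (Or.inr h))
    · rw [smash3ToLeft_mk, smash3ToLeft_mk, Collapse.mk_eq_mk_iff] at h
      rcases h with h | ⟨h1, -⟩
      · obtain ⟨h1, h2⟩ := Prod.mk.inj h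
        rw [Collapse.mk_eq_mk_iff] at h1
        rcases h1 with h1 | ⟨h1, -⟩
        · obtain ⟨h11, h12⟩ := Prod.mk.inj h1
          congr 1
          exact Prod.ext h11 (Prod.ext h12 h2)
        · exfalso
          rcases h1 with h1 | h1
          · exact hp (Or.inl h1)
          · exact hp (Or.inr (Or.inl h1))
      · exfalso
        rcases h1 with h1 | h1
        · change Collapse.mk (prodWedgeC x₀ y₀) (p.1, p.2.1) = Collapse.pt _ at h1
          rw [Collapse.mk_eq_pt_iff] at h1
          rcases h1 with h1 | h1
          · exact hp (Or.inl h1)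
          · exact hp (Or.inr (Or.inl h1))
        · exact hp (Or.inr (Or.inr h1))
  · intro c
    rcases Collapse.eq_pt_or_eq_mk c with rfl | ⟨⟨w, z⟩, hw, rfl⟩
    · exact ⟨Collapse.pt _, rfl⟩
    · rcases Collapse.eq_pt_or_eq_mk w with rfl | ⟨⟨x, y⟩, hxy, rfl⟩
      · exact absurd (Or.inl rfl) hw
      · exact ⟨Collapse.mk _ (x, y, z), rfl⟩

omit [CompactSpace X] in
/-- `smash3ToRight` is a bijection. [cite: HatcherAT2002, Ch. 0 p. 10] -/
theorem smash3ToRight_bijective : Function.Bijective (smash3ToRight x₀ y₀ z₀) := by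
  constructor
  · intro a b h
    rcases Collapse.eq_pt_or_eq_mk a with rfl | ⟨p, hp, rfl⟩ <;> rcases Collapse.eq_pt_or_eq_mk b with rfl | ⟨q, hq, rfl⟩
    · rfl
    · exfalso
      rw [smash3ToRight_pt, smash3ToRight_mk, eq_comm, Collapse.mk_eq_pt_iff] at h
      rcases h with h | h
      · exact hq (Or.inl h)
      · change Collapse.mk (prodWedgeC y₀ z₀) q.2 = Collapse.pt _ at h
        rw [Collapse.mk_eq_pt_iff] at h
        rcases h with h | h
        · exact hq (Or.inr (Or.inl h))
        · exact hq (Or.inr (Or.inr h))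
    · exfalso
      rw [smash3ToRight_pt, smash3ToRight_mk, Collapse.mk_eq_pt_iff] at h
      rcases h with h | h
      · exact hp (Or.inl h)
      · change Collapse.mk (prodWedgeC y₀ z₀) p.2 = Collapse.pt _ at h
        rw [Collapse.mk_eq_pt_iff] at h
        rcases h with h | h
        · exact hp (Or.inr (Or.inl h))
        · exact hp (Or.inr (Or.inr h))
    · rw [smash3ToRight_mk, smash3ToRight_mk, Collapse.mk_eq_mk_iff] at h
      rcases h with h | ⟨h1, -⟩
      · obtain ⟨h1, h2⟩ := Prod.mk.inj h
        rw [Collapse.mk_eq_mk_iff] at h2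
        rcases h2 with h2 | ⟨h2, -⟩
        · congr 1
          exact Prod.ext h1 h2
        · exfalso
          rcases h2 with h2 | h2
          · exact hp (Or.inr (Or.inl h2))
          · exact hp (Or.inr (Or.inr h2))
      · exfalso
        rcases h1 with h1 | h1
        · exact hp (Or.inl h1)
        · change Collapse.mk (prodWedgeC y₀ z₀) p.2 = Collapse.pt _ at h1
          rw [Collapse.mk_eq_pt_iff] at h1
          rcases h1 with h1 | h1
          · exact hp (Or.inr (Or.inl h1))
          · exact hp (Or.inr (Or.inr h1))
  · intro c
    rcases Collapse.eq_pt_or_eq_mk c with rfl | ⟨⟨x, w⟩, hw, rfl⟩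
    · exact ⟨Collapse.pt _, rfl⟩
    · rcases Collapse.eq_pt_or_eq_mk w with rfl | ⟨⟨y, z⟩, hyz, rfl⟩
      · exact absurd (Or.inr rfl) hw
      · exact ⟨Collapse.mk _ (x, y, z), rfl⟩

/-- **`X ∧ Y ∧ Z ≃ₜ (X ∧ Y) ∧ Z`** (continuous bijection from a compact to a Hausdorff space). [cite: HatcherAT2002, Ch. 0 p. 10] -/
def smash3HomeoLeft : Smash3 x₀ y₀ z₀ ≃ₜ SmashL x₀ y₀ z₀ :=
  Continuous.homeoOfEquivCompactToT2 (f := Equiv.ofBijective _ (smash3ToLeft_bijective x₀ y₀ z₀)) (smash3ToLeft x₀ y₀ z₀).continuous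

/-- **`X ∧ Y ∧ Z ≃ₜ X ∧ (Y ∧ Z)`**. [cite: HatcherAT2002, Ch. 0 p. 10] -/
def smash3HomeoRight : Smash3 x₀ y₀ z₀ ≃ₜ SmashR x₀ y₀ z₀ :=
  Continuous.homeoOfEquivCompactToT2 (f := Equiv.ofBijective _ (smash3ToRight_bijective x₀ y₀ z₀)) (smash3ToRight x₀ y₀ z₀).continuous

/-- Smash products (Hatcher AT Ch. 0). [folklore] -/
@[simp] theorem smash3HomeoLeft_apply (c : Smash3 x₀ y₀ z₀) : smash3HomeoLeft x₀ y₀ z₀ c = smash3ToLeft x₀ y₀ z₀ c := rfl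

/-- Smash products (Hatcher AT Ch. 0). [folklore] -/
@[simp] theorem smash3HomeoRight_apply (c : Smash3 x₀ y₀ z₀) : smash3HomeoRight x₀ y₀ z₀ c = smash3ToRight x₀ y₀ z₀ c := rfl

/-- Smash products (Hatcher AT Ch. 0). [folklore] -/
theorem coe_smash3HomeoLeft : ((smash3HomeoLeft x₀ y₀ z₀ : Smash3 x₀ y₀ z₀ ≃ₜ SmashL x₀ y₀ z₀) : C(Smash3 x₀ y₀ z₀, SmashL x₀ y₀ z₀)) =
    smash3ToLeft x₀ y₀ z₀ := rfl

/-- Smash products (Hatcher AT Ch. 0). [folklore] -/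
theorem coe_smash3HomeoRight : ((smash3HomeoRight x₀ y₀ z₀ : Smash3 x₀ y₀ z₀ ≃ₜ SmashR x₀ y₀ z₀) : C(Smash3 x₀ y₀ z₀, SmashR x₀ y₀ z₀)) =
    smash3ToRight x₀ y₀ z₀ := rfl

/-- **The associator `(X ∧ Y) ∧ Z ≃ₜ X ∧ (Y ∧ Z)`.** [cite: HatcherAT2002, Ch. 0 p. 10] -/
def smashAssoc : SmashL x₀ y₀ z₀ ≃ₜ SmashR x₀ y₀ z₀ := (smash3HomeoLeft x₀ y₀ z₀).symm.trans (smash3HomeoRight x₀ y₀ z₀)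

/-- Smash products (Hatcher AT Ch. 0). [folklore] -/
@[simp] theorem smashAssoc_pt :
    smashAssoc x₀ y₀ z₀ (Collapse.pt (prodWedgeC (Collapse.pt (prodWedgeC x₀ y₀)) z₀)) =
      Collapse.pt (prodWedgeC x₀ (Collapse.pt (prodWedgeC y₀ z₀))) := by
  rw [smashAssoc, Homeomorph.trans_apply]
  have h : (smash3HomeoLeft x₀ y₀ z₀).symm (Collapse.pt (prodWedgeC (Collapse.pt (prodWedgeC x₀ y₀)) z₀)) = Collapse.pt (fatWedgeC x₀ y₀ z₀) := by
    rw [Homeomorph.symm_apply_eq]; rfl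
  rw [h]; rfl

/-- Smash products (Hatcher AT Ch. 0). [folklore] -/
theorem smashAssoc_mk_mk (x : X) (y : Y) (z : Z) :
    smashAssoc x₀ y₀ z₀ (Collapse.mk (prodWedgeC (Collapse.pt (prodWedgeC x₀ y₀)) z₀) (Collapse.mk (prodWedgeC x₀ y₀) (x, y), z)) =
      Collapse.mk (prodWedgeC x₀ (Collapse.pt (prodWedgeC y₀ z₀))) (x, Collapse.mk (prodWedgeC y₀ z₀) (y, z)) := by
  rw [smashAssoc, Homeomorph.trans_apply]
  have h : (smash3HomeoLeft x₀ y₀ z₀).symm (Collapse.mk (prodWedgeC (Collapse.pt (prodWedgeC x₀ y₀)) z₀) (Collapse.mk (prodWedgeC x₀ y₀) (x, y), z)) =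
      Collapse.mk (fatWedgeC x₀ y₀ z₀) (x, y, z) := by
    rw [Homeomorph.symm_apply_eq]; rfl
  rw [h]; rfl

/-- The associator intertwines the two collapse maps of the triple product. [cite: HatcherAT2002, Ch. 0 p. 10] -/
theorem smashAssoc_comp :
    ((smashAssoc x₀ y₀ z₀ : SmashL x₀ y₀ z₀ ≃ₜ SmashR x₀ y₀ z₀) : C(SmashL x₀ y₀ z₀, SmashR x₀ y₀ z₀)).comp
        ((Collapse.mk (prodWedgeC (Collapse.pt (prodWedgeC x₀ y₀)) z₀)).comp (prodToL (Z := Z) x₀ y₀)) =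
      (Collapse.mk (prodWedgeC x₀ (Collapse.pt (prodWedgeC y₀ z₀)))).comp (prodToR (X := X) y₀ z₀) := by
  ext ⟨x, y, z⟩
  exact smashAssoc_mk_mk x₀ y₀ z₀ x y z

end Smash3

end Literature.AlgebraicTopology.KTheory

end
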